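import Literature.NumberTheory.DiophantineGeometry.AbcWave0SiegelZerosProofs
import Literature.NumberTheory.LFunctions.RHWave0GRHProofs
import HarnessLib

/-!
# abc.S22 consequent `NoSiegelZerosOddQuadratic`: the GRH link

One-theorem companion of `AbcWave0.lean` / `AbcWave0SiegelZerosProofs.lean` for the open
statement `Literature.NumberTheory.DiophantineGeometry.NoSiegelZerosOddQuadratic` (abc.S22
consequent: some `c > 0` with `L(σ, χ) ≠ 0` for real `σ > 1 - c / log q`, every odd quadratic
primitive `χ` mod `q ≥ 3`; registered OPEN CONJECTURE `[status: open]` in `AbcWave0.lean`).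
Its docstring there records that in the tree the statement follows from "rh.S34 itself, hence
GRH (`Literature.NumberTheory.LFunctions.GeneralizedRiemannHypothesis.noSiegelZeros` in
`RHWave0GRHProofs.lean`, then specialise to odd `χ`)"; this file declares that composite as a
theorem, so that the implication GRH ⟹ abc.S22-consequent is a named, searchable declaration
(e.g. for refuter seats: the statement cannot be refuted short of refuting GRH — "Of course, the
Grand Riemann Hypothesis for the Dirichlet L-functions rules out any exception!"
[cite: IwaniecConversations2006, §1]). Everything else the tree can prove about the statement —
rh.S34 ⟹ it (`noSiegelZerosOddQuadratic_of_noSiegelZeros`), the non-uniform fixed-modulus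
version (`exists_const_LFunction_ne_zero_fixedModulus`), "large conductors suffice"
(`noSiegelZerosOddQuadratic_iff_eventually`) — lives in `AbcWave0SiegelZerosProofs.lean`, and the
Mahler–Granville–Stark criterion `NoSiegelZerosOddQuadratic ↔ L'/L(1, χ) ≤ A log q` in
`AbcWave0GranvilleStarkProofs.lean`; nothing is duplicated here. PROVED theorem only; no
definition, no named fact.
-/

noncomputable section

namespace Literature.NumberTheory.DiophantineGeometry

open Literature.NumberTheory.LFunctions

/-- **GRH ⟹ no Siegel zeros for odd real primitive characters** (rh.S02 ⟹ abc.S22-consequent).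
Under the Generalised Riemann Hypothesis for Dirichlet `L`-functions,
`NoSiegelZerosOddQuadratic` holds (with the constant `c = 1/2` of
`GeneralizedRiemannHypothesis.noSiegelZeros`, then `noSiegelZerosOddQuadratic_of_noSiegelZeros`):
"Of course, the Grand Riemann Hypothesis for the Dirichlet L-functions rules out any exception!"
[cite: IwaniecConversations2006, §1] -/
theorem NoSiegelZerosOddQuadratic.of_generalizedRiemannHypothesis
    (h : GeneralizedRiemannHypothesis) : NoSiegelZerosOddQuadratic :=
  noSiegelZerosOddQuadratic_of_noSiegelZeros h.noSiegelZeros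

end Literature.NumberTheory.DiophantineGeometry

end
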